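import Summits.BirchSwinnertonDyer.BirchSwinnertonDyer.Theorems.ByReductionTypeAtTwoSupersingularLine
import Literature.NumberTheory.EllipticCurves.Kobayashi2003.SignedSelmerModuleFiniteProofs
import HarnessLib

/-!
# Route `ByReductionTypeAtTwo` (rung K4), crux `SupersingularRankZeroAtTwo` (item
# stmt-BirchSwinnertonDyer-19097), line `signed-halves-two`: the FINITE-GENERATION half of stub (2)
# is a TREE THEOREM at `p = 2` — reshaped composition with the signed-control stub shrunk to
# TORSION (or to bottom-layer signed control), seat `bsd-2adic-ss-1` GEN 3

HONEST FRAMING (cell `bsd-2adic`, run/shared/lean/pub/bsd-2adic/, HUMAN RULINGS D-0036/D-0059/D-0074):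
THEOREMS ONLY; no definition, no named fact, no `sorry`; nothing about any Selmer group is asserted
beyond the displayed binders; nothing booked. PARTITION (D-0054): X5@2 good-ss (B1·O1; 757 r0 book230
classes) × p = 2 — types-the-object-of (the `a₂ = 0` sub-row, 208 classes: stub (2) of the line);
closes none. bears_on: K4 (route-BirchSwinnertonDyer-ByReductionTypeAtTwo item 19097).

## What is proved, and why

The registered stub (2) `stub_zeroSignedControl` of line `signed-halves-two` (= binder `hCtl` of the
landed composition `supersingularRankZeroAtTwo_of_line`, p424727) bundles, on the REAL object
`X⁺(E/ℚ_∞)` = `Kobayashi2003.SignedSelmerDualData W κ γ 1`, Kobayashi's Thm. 1.2 READ AT `2`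
("`X⁺` finitely generated AND `Λ`-torsion") with B. D. Kim's Cor. 3.15 READ AT `2`. The barrier entry
`Literature.Barriers.BirchSwinnertonDyer.SignedIwasawaTheoryAtTwoBarrier` (p429189) files Thm. 1.2 at
`2` as "NO citable source, must be PROVED in the tree". Half of it IS ALREADY PROVED IN THE TREE, for
every prime: `Kobayashi2003.SignedSelmerDualData.moduleFinite` (file
`Kobayashi2003/SignedSelmerModuleFiniteProofs.lean`: Nakayama for Pontryagin duals + Greenberg's
"`Sel_∞[𝔪]` is finite", any `p`, any reduction type, any `ℤ_p`-extension). This file records that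
discharge against the crux and RESHAPES the composition accordingly:

* `signedSelmerDual_moduleFinite_two` — the ∀-closed class-level statement "for every `E/ℚ`, every
  `ℤ₂`-extension `κ` with topological generator `γ`, every sign `ε` and every dual datum `D` of
  `Sel^ε(E/ℚ_∞)`, `X^ε = D.X` is a finitely generated `ℤ₂⟦T⟧`-module" — PROVED (it is the tree
  theorem); so the `Module.Finite` clause of stub (2) carries no open content.
* `supersingularRankZeroAtTwo_of_line_torsion` — the crux from SIX stub groups: (1) PUB, (2a) **`X⁺`
  is `Λ`-TORSION** at `2` on `a₂ = 0` (the genuinely open half of Kobayashi Thm. 1.2 at `2`: Kato's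
  theorem through the `±` Coleman maps, Kobayashi §6–§9, printed for odd `p`), (2b) Kim Cor. 3.15 at
  `2` (verbatim the second conjunct of the old stub (2)), (3) `KobayashiLowerDivisibility W 2 1`,
  (4) Kato-side signed divisibility at `2`, (5) the `a₂ = ±2` Miller halves — by feeding
  `supersingularRankZeroAtTwo_of_line` the pair ⟨tree theorem, (2a)⟩.
* `supersingularRankZeroAtTwo_of_line_invariants` — the same with (2a) replaced by the RANK-`0`
  bottom-layer signed control **"`Sel⁺(E/ℚ_∞)^Γ` is finite"** (`Finite (endInvariants (conj_γ − 1))`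
  on `Sel⁺(E/ℚ_∞)`), which gives torsion by the tree theorem
  `SignedSelmerDualData.isTorsion_of_finite_endInvariants` (Greenberg Thm. 1.4 / Lemma 4.2 shape; it
  also gives `g(0) ≠ 0` for a characteristic generator). In analytic rank `0` this is what Kobayashi's
  control theorem (Thm. 9.3 at `n = 0`, where `Sel⁺(E/ℚ) = Sel(E/ℚ)` is finite by GZK) supplies at
  odd `p`; at `2` it is the open input, now isolated.

Nothing else changes: stub groups (1), (2b), (3), (4), (5) are passed through verbatim.

References: S. Kobayashi, Invent. Math. 152 (2003), Thm. 1.2 (p. 2), Thm. 9.3 [Kobayashi2003];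
R. Greenberg, LNM 1716 (1999), §1 p. 60, Thm. 1.4, Lemma 4.2 [GreenbergLNM1716]; B. D. Kim,
J. Aust. Math. Soc. 95 (2013), Cor. 3.15 [BDKim2013].
-/

set_option autoImplicit false
-- the Theorems namespace of this sub repeats the summit name by design (D-0017 nested layout)
set_option linter.dupNamespace false

noncomputable section

open scoped Classical MatrixGroups ModularForm

open CongruenceSubgroup WeierstrassCurve Literature.NumberTheory.EllipticCurves
  Literature.NumberTheory.EllipticCurves.ModularForms
  Literature.NumberTheory.EllipticCurves.Rank1Residual Literature.NumberTheory.EllipticCurves.Rank1Residual.Typed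
  Literature.NumberTheory.EllipticCurves.Kobayashi2003 Literature.NumberTheory.EllipticCurves.IwasawaDual
  ZpExtension Summit.BirchSwinnertonDyer.Rank1Residual.Supersingular

namespace Summit.BirchSwinnertonDyer.BirchSwinnertonDyer.Theorems

/-! ## §1 The finite-generation clause of stub (2) is a tree theorem at `p = 2` -/

/-- **`X^ε(E/ℚ_∞)` is finitely generated over `ℤ₂⟦T⟧`, for every `E/ℚ`, every `ℤ₂`-extension with a
topological generator, every sign and every dual datum** — the ∀-closed class-level form of the
`Module.Finite` clause of the registered stub `stub_zeroSignedControl` of line `signed-halves-two`,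
PROVED: it is the tree theorem `Kobayashi2003.SignedSelmerDualData.moduleFinite` read at `p = 2`
(Nakayama for Pontryagin duals; Greenberg §1 p. 60, "any prime `p`, no restriction on the reduction
type"). The hypotheses `¬HasCM`, `analyticRank = 0`, `GoodSS W 2`, `a₂ = 0`, `κ.IsCyclotomic` of the
stub are displayed and unused. [cite: GreenbergLNM1716, §1 p. 60 (after Conj. 1.3)] [cite: Kobayashi2003, Thm. 1.2 (p. 2)] -/
theorem signedSelmerDual_moduleFinite_two [Fact (Nat.Prime 2)] :
    ∀ (W : WeierstrassCurve ℚ) [W.IsElliptic] [W.IsGloballyMinimal],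
      ¬ W.HasCM → W.analyticRank = 0 → GoodSS W 2 → W.frobeniusTrace 2 = 0 →
      ∀ (κ : ZpExtension ℚ 2) (γ : Field.absoluteGaloisGroup ℚ),
        κ.IsCyclotomic → κ.IsTopGenerator γ →
        ∀ (ε : ℤˣ) (D : SignedSelmerDualData W κ γ ε), Module.Finite (IwasawaAlgebra 2) D.X := by
  intro W _ _ _ _ _ _ κ γ _ hγ ε D
  exact D.moduleFinite hγ

/-! ## §2 The reshaped composition: stub (2) shrunk to TORSION -/

/-- **The crux from the RESHAPED stub groups of line `signed-halves-two`** — (1) PUB {modularity,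
GZK}; (2a) `a₂ = 0`: `X⁺(E/ℚ_∞)` is `Λ`-TORSION at `2` (the open half of Kobayashi Thm. 1.2 at `2`);
(2b) `a₂ = 0`: B. D. Kim Cor. 3.15 at `2`; (3) `a₂ = 0`: `KobayashiLowerDivisibility W 2 1`; (4)
`a₂ = 0`: the Kato-side signed divisibility at `2`; (5) `a₂ = ±2`: the Miller halves — by the landed
`supersingularRankZeroAtTwo_of_line`, its binder `hCtl` being assembled from the TREE THEOREM
`SignedSelmerDualData.moduleFinite` and (2a). Composition certificate; nothing asserted beyond the
binders. [cite: Kobayashi2003, Thm. 1.2 (p. 2)] [cite: BDKim2013, Cor. 3.15 (p. 199)]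
[cite: GreenbergLNM1716, §1 p. 60 (after Conj. 1.3)] [cite: Miller2011LMS, Def. 1.1] -/
theorem supersingularRankZeroAtTwo_of_line_torsion
    (hPub : nonempty_modularParametrizationData ∧ rank_eq_analyticRank_of_analyticRank_le_one)
    (hTor : ∀ (W : WeierstrassCurve ℚ) [W.IsElliptic] [W.IsGloballyMinimal],
        ¬ W.HasCM → W.analyticRank = 0 → GoodSS W 2 → W.frobeniusTrace 2 = 0 →
        ∀ (κ : ZpExtension ℚ 2) (γ : Field.absoluteGaloisGroup ℚ),
          κ.IsCyclotomic → κ.IsTopGenerator γ →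
          ∀ D : SignedSelmerDualData W κ γ 1, Module.IsTorsion (IwasawaAlgebra 2) D.X)
    (hKim : ∀ (W : WeierstrassCurve ℚ) [W.IsElliptic] [W.IsGloballyMinimal],
        ¬ W.HasCM → W.analyticRank = 0 → GoodSS W 2 → W.frobeniusTrace 2 = 0 →
        ∀ (κ : ZpExtension ℚ 2) (γ : Field.absoluteGaloisGroup ℚ),
          κ.IsCyclotomic → κ.IsTopGenerator γ →
          ∀ (D : SignedSelmerDualData W κ γ 1) [Module.Finite (IwasawaAlgebra 2) D.X],
            Module.IsTorsion (IwasawaAlgebra 2) D.X →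
          ∀ g : IwasawaAlgebra 2, D.charIdeal = Ideal.span {g} → Finite (W.selmerGroupPInfty 2) →
            ∃ u : ℤ_[2]ˣ, ((PowerSeries.constantCoeff g : ℤ_[2]) : ℚ_[2]) =
              ((u : ℤ_[2]) : ℚ_[2]) * ((2 : ℕ) : ℚ_[2]) ^ (padicValNat 2 W.tamagawaProduct) *
                (Nat.card (W.selmerGroupPInfty 2) : ℚ_[2]))
    (hlow : ∀ (W : WeierstrassCurve ℚ) [W.IsElliptic] [W.IsGloballyMinimal],
      ¬ W.HasCM → W.analyticRank = 0 → GoodSS W 2 → W.frobeniusTrace 2 = 0 →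
        KobayashiLowerDivisibility W 2 1)
    (hup : ∀ (W : WeierstrassCurve ℚ) [W.IsElliptic] [W.IsGloballyMinimal],
      ¬ W.HasCM → W.analyticRank = 0 → GoodSS W 2 → W.frobeniusTrace 2 = 0 →
      ∀ (κ : ZpExtension ℚ 2) (γ : Field.absoluteGaloisGroup ℚ),
        κ.IsCyclotomic → κ.IsTopGenerator γ → IsCyclotomicVariable 2 γ →
        ∀ [NeZero (W.conductorNorm ℤ)] (f : CuspForm (Gamma0 (W.conductorNorm ℤ)) 2),
          IsNewformOf W f → ∀ (ϖ : ℚ), (ϖ : ℝ) * W.realPeriodRat = plusPeriod f →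
        ∀ (Lplus Lminus : IwasawaAlgebra 2), IsPollackPair f 2 Lplus Lminus →
        ∀ (D : SignedSelmerDualData W κ γ 1),
          ∃ g h : IwasawaAlgebra 2, D.charIdeal = Ideal.span {g} ∧
            iwasawaToPowerSeries 2 (g * h) =
              PowerSeries.C (ϖ : ℚ_[2]) * iwasawaToPowerSeries 2 (kobayashiL 1 Lplus Lminus))
    (hTwo : (∀ (W : WeierstrassCurve ℚ) [W.IsElliptic] [W.IsGloballyMinimal],
        ¬ W.HasCM → W.analyticRank = 0 → GoodSS W 2 →
          (W.frobeniusTrace 2 = 2 ∨ W.frobeniusTrace 2 = -2) → MissingLowerBoundAt W 2) ∧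
      (∀ (W : WeierstrassCurve ℚ) [W.IsElliptic] [W.IsGloballyMinimal],
        ¬ W.HasCM → W.analyticRank = 0 → GoodSS W 2 →
          (W.frobeniusTrace 2 = 2 ∨ W.frobeniusTrace 2 = -2) → MissingUpperBoundAt W 2)) :
    Summit.BirchSwinnertonDyer.BirchSwinnertonDyer.Theses.ByReductionTypeAtTwo.SupersingularRankZeroAtTwo :=
  supersingularRankZeroAtTwo_of_line hPub
    ⟨fun W _ _ hcm hr hss ha κ γ hκ hγ D ↦ ⟨D.moduleFinite hγ, hTor W hcm hr hss ha κ γ hκ hγ D⟩, hKim⟩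
    hlow hup hTwo

/-! ## §3 The same with (2a) as bottom-layer signed control: `Sel⁺(E/ℚ_∞)^Γ` finite -/

/-- **Torsion of `X⁺(E/ℚ_∞)` at `2` from the finiteness of `Sel⁺(E/ℚ_∞)^Γ`** (the tree theorem
`SignedSelmerDualData.isTorsion_of_finite_endInvariants`, Greenberg Thm. 1.4 / Lemma 4.2 shape, read
at `p = 2` and ∀-closed over the `a₂ = 0` sub-row): the rank-`0` bottom-layer signed control implies
stub (2a). [cite: GreenbergLNM1716, Thm. 1.4 (p. 61) and §4 Lemma 4.2 (p. 102)] [cite: Kobayashi2003, Thm. 1.2 and Thm. 9.3] -/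
theorem signedSelmerDual_isTorsion_two_of_finite_invariants [Fact (Nat.Prime 2)]
    (hInv : ∀ (W : WeierstrassCurve ℚ) [W.IsElliptic] [W.IsGloballyMinimal],
        ¬ W.HasCM → W.analyticRank = 0 → GoodSS W 2 → W.frobeniusTrace 2 = 0 →
        ∀ (κ : ZpExtension ℚ 2) (γ : Field.absoluteGaloisGroup ℚ),
          κ.IsCyclotomic → κ.IsTopGenerator γ →
          Finite (endInvariants (conjSignedSelmerInfty W κ 1 γ - 1))) :
    ∀ (W : WeierstrassCurve ℚ) [W.IsElliptic] [W.IsGloballyMinimal],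
      ¬ W.HasCM → W.analyticRank = 0 → GoodSS W 2 → W.frobeniusTrace 2 = 0 →
      ∀ (κ : ZpExtension ℚ 2) (γ : Field.absoluteGaloisGroup ℚ),
        κ.IsCyclotomic → κ.IsTopGenerator γ →
        ∀ D : SignedSelmerDualData W κ γ 1, Module.IsTorsion (IwasawaAlgebra 2) D.X := by
  intro W _ _ hcm hr hss ha κ γ hκ hγ D
  exact D.isTorsion_of_finite_endInvariants hγ (hInv W hcm hr hss ha κ γ hκ hγ)

/-- **The crux with stub (2a) read as bottom-layer signed control** — (1) PUB; (2a′) `a₂ = 0`: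
`Sel⁺(E/ℚ_∞)^Γ` is finite (in analytic rank `0`: Kobayashi's control theorem Thm. 9.3 at `n = 0`,
where `Sel⁺(E/ℚ) = Sel(E/ℚ)` is finite by GZK — printed for odd `p`); (2b) Kim Cor. 3.15 at `2`; (3),
(4), (5) as in `supersingularRankZeroAtTwo_of_line_torsion`. [cite: Kobayashi2003, Thm. 1.2 and Thm. 9.3]
[cite: GreenbergLNM1716, Thm. 1.4 (p. 61) and §4 Lemma 4.2 (p. 102)] [cite: BDKim2013, Cor. 3.15 (p. 199)]
[cite: Miller2011LMS, Def. 1.1] -/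
theorem supersingularRankZeroAtTwo_of_line_invariants
    (hPub : nonempty_modularParametrizationData ∧ rank_eq_analyticRank_of_analyticRank_le_one)
    (hInv : ∀ (W : WeierstrassCurve ℚ) [W.IsElliptic] [W.IsGloballyMinimal],
        ¬ W.HasCM → W.analyticRank = 0 → GoodSS W 2 → W.frobeniusTrace 2 = 0 →
        ∀ (κ : ZpExtension ℚ 2) (γ : Field.absoluteGaloisGroup ℚ),
          κ.IsCyclotomic → κ.IsTopGenerator γ →
          Finite (endInvariants (conjSignedSelmerInfty W κ 1 γ - 1)))
    (hKim : ∀ (W : WeierstrassCurve ℚ) [W.IsElliptic] [W.IsGloballyMinimal],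
        ¬ W.HasCM → W.analyticRank = 0 → GoodSS W 2 → W.frobeniusTrace 2 = 0 →
        ∀ (κ : ZpExtension ℚ 2) (γ : Field.absoluteGaloisGroup ℚ),
          κ.IsCyclotomic → κ.IsTopGenerator γ →
          ∀ (D : SignedSelmerDualData W κ γ 1) [Module.Finite (IwasawaAlgebra 2) D.X],
            Module.IsTorsion (IwasawaAlgebra 2) D.X →
          ∀ g : IwasawaAlgebra 2, D.charIdeal = Ideal.span {g} → Finite (W.selmerGroupPInfty 2) →
            ∃ u : ℤ_[2]ˣ, ((PowerSeries.constantCoeff g : ℤ_[2]) : ℚ_[2]) =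
              ((u : ℤ_[2]) : ℚ_[2]) * ((2 : ℕ) : ℚ_[2]) ^ (padicValNat 2 W.tamagawaProduct) *
                (Nat.card (W.selmerGroupPInfty 2) : ℚ_[2]))
    (hlow : ∀ (W : WeierstrassCurve ℚ) [W.IsElliptic] [W.IsGloballyMinimal],
      ¬ W.HasCM → W.analyticRank = 0 → GoodSS W 2 → W.frobeniusTrace 2 = 0 →
        KobayashiLowerDivisibility W 2 1)
    (hup : ∀ (W : WeierstrassCurve ℚ) [W.IsElliptic] [W.IsGloballyMinimal],
      ¬ W.HasCM → W.analyticRank = 0 → GoodSS W 2 → W.frobeniusTrace 2 = 0 →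
      ∀ (κ : ZpExtension ℚ 2) (γ : Field.absoluteGaloisGroup ℚ),
        κ.IsCyclotomic → κ.IsTopGenerator γ → IsCyclotomicVariable 2 γ →
        ∀ [NeZero (W.conductorNorm ℤ)] (f : CuspForm (Gamma0 (W.conductorNorm ℤ)) 2),
          IsNewformOf W f → ∀ (ϖ : ℚ), (ϖ : ℝ) * W.realPeriodRat = plusPeriod f →
        ∀ (Lplus Lminus : IwasawaAlgebra 2), IsPollackPair f 2 Lplus Lminus →
        ∀ (D : SignedSelmerDualData W κ γ 1),
          ∃ g h : IwasawaAlgebra 2, D.charIdeal = Ideal.span {g} ∧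
            iwasawaToPowerSeries 2 (g * h) =
              PowerSeries.C (ϖ : ℚ_[2]) * iwasawaToPowerSeries 2 (kobayashiL 1 Lplus Lminus))
    (hTwo : (∀ (W : WeierstrassCurve ℚ) [W.IsElliptic] [W.IsGloballyMinimal],
        ¬ W.HasCM → W.analyticRank = 0 → GoodSS W 2 →
          (W.frobeniusTrace 2 = 2 ∨ W.frobeniusTrace 2 = -2) → MissingLowerBoundAt W 2) ∧
      (∀ (W : WeierstrassCurve ℚ) [W.IsElliptic] [W.IsGloballyMinimal],
        ¬ W.HasCM → W.analyticRank = 0 → GoodSS W 2 →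
          (W.frobeniusTrace 2 = 2 ∨ W.frobeniusTrace 2 = -2) → MissingUpperBoundAt W 2)) :
    Summit.BirchSwinnertonDyer.BirchSwinnertonDyer.Theses.ByReductionTypeAtTwo.SupersingularRankZeroAtTwo :=
  supersingularRankZeroAtTwo_of_line_torsion hPub
    (signedSelmerDual_isTorsion_two_of_finite_invariants hInv) hKim hlow hup hTwo

end Summit.BirchSwinnertonDyer.BirchSwinnertonDyer.Theorems

end
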